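import Literature.AlgebraicGeometry.Frobenioids.Prop53Sub
import HarnessLib

/-!
# Frobenioids I, Corollary 5.4, sub-DAG row C54/L07 `OneUniqueData`: a functor between model
# Frobenioids of group subfunctors is determined, up to isomorphism, by `(Ψ^Base, Ψ^Φ)`

Mochizuki, *The geometry of Frobenioids I: the general theory*, Kyushu J. Math. **62** (2008)
293–400, §5, Corollary 5.4 (Category-theoreticity of the Realification), kurims text p. 104 ll. 1–6
("there exists a 1-unique functor `Ψ^rlf : C₁^rlf → C₂^rlf` …") with proof ll. 21–22 ("follows
immediately from Corollaries 4.10; 4.11, (iii), (iv)"), and Theorem 5.2 (i) p. 100 (the morphisms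
`(deg_Fr, Base, Div, u)` of a model Frobenioid and their defining relation)
[cite: MochizukiFrdI2008, Cor. 5.4 p.104] [cite: MochizukiFrdI2008, Thm. 5.2 (i) p.100].

PROOF-ONLY companion (abc-iut cell, layer L1, sub-DAG `SUBDAG-FrdI-Prop53-Cor54.md` of seat
abc-iut-w5-d137, row **C54/L07** `FrdI.Cor54Sub.OneUniqueData` of `Prop53Sub.lean` — the HONEST form of
the 1-uniqueness clause: "two functors `C₁^rlf → C₂^rlf` induced by the SAME data `(Ψ^Base, (Ψ^Φ)^rlf)` are
isomorphic"; this file: seat abc-iut-w5-d221).  We prove the statement UNCONDITIONALLY, and in its natural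
generality: for model Frobenioids `Ψ₁.ModelOf`, `Ψ₂.ModelOf` of arbitrary subfunctors of groups
`Ψ_i ⊆ Φ_i^gp` (seat abc-iut-L1-t5, `GroupSubfunctors.lean`; `C^rlf` is the case `Φ := Φ^rlf`,
`Ψ := ℝ · Φ^birat`), a functor `Ψ^Base : D₁ → D₂` and ANY family of maps `E_A : Φ₁(A) → Φ₂(Ψ^Base A)`,
two functors `G, G' : Ψ₁.ModelOf → Ψ₂.ModelOf` each lying over `Ψ^Base` (`η : Base ∘ G ≅ Ψ^Base ∘ Base`),
preserving Frobenius degrees and carrying zero divisors by `E` through `η` (`Div(G φ) = η_A^* E(Div φ)` — the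
three conclusions of `RlfTransport` / the three clauses of `IsInducedBy`) are isomorphic
(`nonempty_iso`).  The point of the proof (Thm. 5.2 (i)): in a model Frobenioid whose rational-function
monoid `B = Ψ ⊆ Φ^gp` has `Div_B` the inclusion, a morphism is determined by `(deg_Fr, Base, Div)`
(`hom_eq`), and the second components `α` of the image objects of `G`, `G'` differ, after transport along
`η`, `η'`, by an element of `Ψ₂` (`cls_div_mem`) — read off the images of the morphisms
`(1, id, z, 1) : (A, α) → (A, α + z)` and `(2, id, 0, 1) : (A, α) → (A, 2α)` of `Ψ₁.ModelOf`.
Slot binding: `FrdI.Cor54Sub.oneUniqueData_holds : OneUniqueData F₁ hΦ₁ F₂ hΦ₂ ΨBase Erlf` for every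
`Ψ^Base`, `Erlf`.  No definition, no new `Prop` fact; no statement of the paper is strengthened; nothing here
bears on [IUTchIII] Cor. 3.12.
-/

namespace Literature.AlgebraicGeometry.Frobenioids

open CategoryTheory Opposite

universe w v₁' u₁' v₂' u₂'

namespace PreFrobenioid

namespace Cor54Unique

variable {D₁ : Type u₁'} [Category.{v₁'} D₁] {Φ₁ : D₁ᵒᵖ ⥤ CommMonCat.{w}} (Ψ₁ : GpSubfunctor Φ₁)
  {D₂ : Type u₂'} [Category.{v₂'} D₂] {Φ₂ : D₂ᵒᵖ ⥤ CommMonCat.{w}} (Ψ₂ : GpSubfunctor Φ₂)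

/-! ### Model Frobenioids of group subfunctors: a morphism is determined by `(deg_Fr, Base, Div)` -/

/-- **In `Ψ.ModelOf` a morphism is determined by `(deg_Fr, Base, Div)`**: the relation
`deg_Fr(φ) · α + Div(φ) = Φ(Base φ)(β) + Div_B(u_φ)` of Thm. 5.2 (i) determines `Div_B(u_φ)`, and `Div_B` is
the (injective) inclusion `Ψ ⊆ Φ^gp`. [cite: MochizukiFrdI2008, Thm. 5.2 (i) p.100] -/
theorem hom_eq {X Y : Ψ₂.ModelOf} {φ ψ : X ⟶ Y} (h₁ : ModelFrobenioid.degFr φ = ModelFrobenioid.degFr ψ)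
    (h₂ : ModelFrobenioid.baseMap φ = ModelFrobenioid.baseMap ψ)
    (h₃ : ModelFrobenioid.div φ = ModelFrobenioid.div ψ) : φ = ψ := by
  apply ModelFrobenioid.hom_ext h₁ h₂ h₃
  have r₁ := ModelFrobenioid.rel φ
  have r₂ := ModelFrobenioid.rel ψ
  rw [h₁, h₂, h₃, r₂] at r₁
  exact Subtype.ext (mul_left_cancel r₁).symm

/-! ### Pull-backs along an isomorphism and its inverse -/

/-- `Φ(e⁻¹)(Φ(e) y) = y` on `Φ`. [cite: MochizukiFrdI2008, Def. 1.1 (ii) p.19] -/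
private theorem pull_inv_hom {X Y : D₂} (e : X ≅ Y) (y : Φ₂.obj (op Y)) :
    pull Φ₂ e.inv (pull Φ₂ e.hom y) = y := by
  rw [← pull_comp, Iso.inv_hom_id, pull_id]

/-- `Φ(e)(Φ(e⁻¹) c) = c` on `Φ^gp`. [cite: MochizukiFrdI2008, Def. 1.1 (ii) p.19] -/
private theorem pullGp_hom_inv {X Y : D₂} (e : X ≅ Y) (c : Algebra.GrothendieckGroup (Φ₂.obj (op X))) :
    pullGp Φ₂ e.hom (pullGp Φ₂ e.inv c) = c := by
  rw [← pullGp_comp, Iso.hom_inv_id, pullGp_id]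

/-- `Φ(g)` on `Φ^gp` extends `Φ(g)` on `Φ`. [cite: MochizukiFrdI2008, Def. 1.1 (ii) p.19] -/
private theorem pullGp_of_pull {X Y : D₂} (g : X ⟶ Y) (y : Φ₂.obj (op Y)) :
    pullGp Φ₂ g (Algebra.GrothendieckGroup.of y) = Algebra.GrothendieckGroup.of (pull Φ₂ g y) :=
  pullGp_of g y

/-- Every element of `M^gp` is a fraction `a / b` of elements of `M` (§0 p. 11). [folklore] -/
private theorem exists_mul_of_eq_of {M : Type w} [CommMonoid M] (γ : Algebra.GrothendieckGroup M) :
    ∃ a b : M, γ * Algebra.GrothendieckGroup.of b = Algebra.GrothendieckGroup.of a := by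
  induction γ using Localization.induction_on with
  | H y =>
    refine ⟨y.1, y.2, ?_⟩
    rw [Localization.mk_eq_monoidOf_mk'_apply]
    exact Submonoid.LocalizationMap.mk'_spec _ _ _

/-! ### Functors induced by `(Ψ^Base, E)`: the transported relation of an image morphism -/

section Induced

variable (ΨBase : D₁ ⥤ D₂) (E : ∀ A : D₁, Φ₁.obj (op A) → Φ₂.obj (op (ΨBase.obj A)))
  (G : Ψ₁.ModelOf ⥤ Ψ₂.ModelOf) (η : ∀ X : Ψ₁.ModelOf, (G.obj X).base ≅ ΨBase.obj X.base)
  (ηnat : ∀ ⦃X Y : Ψ₁.ModelOf⦄ (f : X ⟶ Y),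
    ModelFrobenioid.baseMap (G.map f) ≫ (η Y).hom = (η X).hom ≫ ΨBase.map (ModelFrobenioid.baseMap f))
  (hdeg : ∀ ⦃X Y : Ψ₁.ModelOf⦄ (f : X ⟶ Y), ModelFrobenioid.degFr (G.map f) = ModelFrobenioid.degFr f)
  (hdiv : ∀ ⦃X Y : Ψ₁.ModelOf⦄ (f : X ⟶ Y),
    ModelFrobenioid.div (G.map f) = pull Φ₂ (η X).hom (E X.base (ModelFrobenioid.div f)))

include ηnat in
/-- `η_X⁻¹ ∘ Base(G f) = Ψ^Base(Base f) ∘ η_Y⁻¹` (the naturality of `η`, inverted).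
[cite: MochizukiFrdI2008, Cor. 5.4 p.104] -/
theorem inv_comp_baseMap {X Y : Ψ₁.ModelOf} (f : X ⟶ Y) :
    (η X).inv ≫ ModelFrobenioid.baseMap (G.map f) = ΨBase.map (ModelFrobenioid.baseMap f) ≫ (η Y).inv := by
  rw [Iso.inv_comp_eq, ← Category.assoc, Iso.eq_comp_inv, ηnat f]

include ηnat hdeg hdiv in
/-- **The relation of `G f`, transported to `Φ₂(Ψ^Base A)^gp` along `η`**: for `f : (A, α) → (B, β)` of
`Ψ₁.ModelOf` with image `G f = (d, Base(G f), η_A^* E(Div f), u)`, writing `a := Φ(η_A⁻¹)(cls(G(A, α)))`,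
`b := Φ(η_B⁻¹)(cls(G(B, β)))`: `d · a + E(Div f) = Φ(Ψ^Base(Base f))(b) + Φ(η_A⁻¹)(Div_B u)`.
[cite: MochizukiFrdI2008, Thm. 5.2 (i) p.100] -/
theorem rel_transport {X Y : Ψ₁.ModelOf} (f : X ⟶ Y) :
    pullGp Φ₂ (η X).inv (G.obj X).cls ^ (ModelFrobenioid.degFr f : ℕ) *
        Algebra.GrothendieckGroup.of (E X.base (ModelFrobenioid.div f)) =
      pullGp Φ₂ (ΨBase.map (ModelFrobenioid.baseMap f)) (pullGp Φ₂ (η Y).inv (G.obj Y).cls) *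
        pullGp Φ₂ (η X).inv (divB Φ₂ Ψ₂.toMonoid Ψ₂.incl (op (G.obj X).base)
          (ModelFrobenioid.unit (G.map f))) := by
  have r := congrArg (pullGp Φ₂ (η X).inv) (ModelFrobenioid.rel (G.map f))
  rw [hdeg f, hdiv f, map_mul, map_pow, map_mul, pullGp_of_pull, pull_inv_hom, ← pullGp_comp,
    inv_comp_baseMap Ψ₁ Ψ₂ ΨBase G η ηnat f, pullGp_comp] at r
  exact r

/-- `Φ(η_A⁻¹)(Div_B u_{G f})` lies in `Ψ₂(Ψ^Base A)`. [cite: MochizukiFrdI2008, Thm. 5.2 (i) p.100] -/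
theorem unit_transport_mem {X Y : Ψ₁.ModelOf} (f : X ⟶ Y) :
    pullGp Φ₂ (η X).inv (divB Φ₂ Ψ₂.toMonoid Ψ₂.incl (op (G.obj X).base)
        (ModelFrobenioid.unit (G.map f))) ∈ Ψ₂.carrier (ΨBase.obj X.base) :=
  Ψ₂.pull_mem _ (ModelFrobenioid.unit (G.map f)).2

end Induced

/-! ### Two induced functors: the transported classes differ by elements of `Ψ₂` -/

section Two

variable (ΨBase : D₁ ⥤ D₂) (E : ∀ A : D₁, Φ₁.obj (op A) → Φ₂.obj (op (ΨBase.obj A)))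
  (G : Ψ₁.ModelOf ⥤ Ψ₂.ModelOf) (η : ∀ X : Ψ₁.ModelOf, (G.obj X).base ≅ ΨBase.obj X.base)
  (ηnat : ∀ ⦃X Y : Ψ₁.ModelOf⦄ (f : X ⟶ Y),
    ModelFrobenioid.baseMap (G.map f) ≫ (η Y).hom = (η X).hom ≫ ΨBase.map (ModelFrobenioid.baseMap f))
  (hdeg : ∀ ⦃X Y : Ψ₁.ModelOf⦄ (f : X ⟶ Y), ModelFrobenioid.degFr (G.map f) = ModelFrobenioid.degFr f)
  (hdiv : ∀ ⦃X Y : Ψ₁.ModelOf⦄ (f : X ⟶ Y),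
    ModelFrobenioid.div (G.map f) = pull Φ₂ (η X).hom (E X.base (ModelFrobenioid.div f)))
  (G' : Ψ₁.ModelOf ⥤ Ψ₂.ModelOf) (η' : ∀ X : Ψ₁.ModelOf, (G'.obj X).base ≅ ΨBase.obj X.base)
  (ηnat' : ∀ ⦃X Y : Ψ₁.ModelOf⦄ (f : X ⟶ Y),
    ModelFrobenioid.baseMap (G'.map f) ≫ (η' Y).hom = (η' X).hom ≫ ΨBase.map (ModelFrobenioid.baseMap f))
  (hdeg' : ∀ ⦃X Y : Ψ₁.ModelOf⦄ (f : X ⟶ Y), ModelFrobenioid.degFr (G'.map f) = ModelFrobenioid.degFr f)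
  (hdiv' : ∀ ⦃X Y : Ψ₁.ModelOf⦄ (f : X ⟶ Y),
    ModelFrobenioid.div (G'.map f) = pull Φ₂ (η' X).hom (E X.base (ModelFrobenioid.div f)))

include ηnat hdeg hdiv ηnat' hdeg' hdiv' in
/-- **The two transported relations, divided**: for `f : X → Y` of Frobenius degree `d` over `Base f`, the
quotient `n(X) := Φ(η_X⁻¹)(cls G X) / Φ(η'_X⁻¹)(cls G' X)` satisfies
`n(X)^d / Φ(Ψ^Base(Base f))(n(Y)) ∈ Ψ₂(Ψ^Base X_D)` (it is a quotient of two transported `Div_B u`'s).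
[cite: MochizukiFrdI2008, Thm. 5.2 (i) p.100] -/
theorem quot_mem {X Y : Ψ₁.ModelOf} (f : X ⟶ Y) :
    (pullGp Φ₂ (η X).inv (G.obj X).cls / pullGp Φ₂ (η' X).inv (G'.obj X).cls) ^
          (ModelFrobenioid.degFr f : ℕ) /
        pullGp Φ₂ (ΨBase.map (ModelFrobenioid.baseMap f))
          (pullGp Φ₂ (η Y).inv (G.obj Y).cls / pullGp Φ₂ (η' Y).inv (G'.obj Y).cls) ∈
      Ψ₂.carrier (ΨBase.obj X.base) := by
  have r₁ := rel_transport Ψ₁ Ψ₂ ΨBase E G η ηnat hdeg hdiv f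
  have r₂ := rel_transport Ψ₁ Ψ₂ ΨBase E G' η' ηnat' hdeg' hdiv' f
  have key : (pullGp Φ₂ (η X).inv (G.obj X).cls / pullGp Φ₂ (η' X).inv (G'.obj X).cls) ^
          (ModelFrobenioid.degFr f : ℕ) /
        pullGp Φ₂ (ΨBase.map (ModelFrobenioid.baseMap f))
          (pullGp Φ₂ (η Y).inv (G.obj Y).cls / pullGp Φ₂ (η' Y).inv (G'.obj Y).cls) =
      pullGp Φ₂ (η X).inv (divB Φ₂ Ψ₂.toMonoid Ψ₂.incl (op (G.obj X).base)
          (ModelFrobenioid.unit (G.map f))) /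
        pullGp Φ₂ (η' X).inv (divB Φ₂ Ψ₂.toMonoid Ψ₂.incl (op (G'.obj X).base)
          (ModelFrobenioid.unit (G'.map f))) := by
    rw [div_pow, map_div, eq_div_iff_mul_eq'.mpr r₁, eq_div_iff_mul_eq'.mpr r₂, div_div_div_cancel_right,
      mul_div_mul_comm, mul_div_cancel_left]
  rw [key]
  exact Subgroup.div_mem _ (unit_transport_mem Ψ₁ Ψ₂ ΨBase G η f)
    (unit_transport_mem Ψ₁ Ψ₂ ΨBase G' η' f)

include ηnat hdeg hdiv ηnat' hdeg' hdiv' in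
/-- The morphism `(1, id, z, 1) : (A, α) → (A, α + z)` of `Ψ₁.ModelOf` gives
`n(A, α) / n(A, α + z) ∈ Ψ₂(Ψ^Base A)`. [cite: MochizukiFrdI2008, Thm. 5.2 (i) p.100] -/
theorem quot_mem_mul_of (A : D₁) (α : Algebra.GrothendieckGroup (Φ₁.obj (op A))) (z : Φ₁.obj (op A)) :
    (pullGp Φ₂ (η ⟨A, α⟩).inv (G.obj ⟨A, α⟩).cls / pullGp Φ₂ (η' ⟨A, α⟩).inv (G'.obj ⟨A, α⟩).cls) /
        (pullGp Φ₂ (η ⟨A, α * Algebra.GrothendieckGroup.of z⟩).inv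
            (G.obj ⟨A, α * Algebra.GrothendieckGroup.of z⟩).cls /
          pullGp Φ₂ (η' ⟨A, α * Algebra.GrothendieckGroup.of z⟩).inv
            (G'.obj ⟨A, α * Algebra.GrothendieckGroup.of z⟩).cls) ∈
      Ψ₂.carrier (ΨBase.obj A) := by
  -- the morphism `(1, id, z, 1)`
  let s : (⟨A, α⟩ : Ψ₁.ModelOf) ⟶ ⟨A, α * Algebra.GrothendieckGroup.of z⟩ :=
    { degFr := 1
      base := 𝟙 A
      div := z
      unit := 1
      rel := by
        show α ^ ((1 : ℕ+) : ℕ) * Algebra.GrothendieckGroup.of z =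
          pullGp Φ₁ (𝟙 A) (α * Algebra.GrothendieckGroup.of z) * divB Φ₁ Ψ₁.toMonoid Ψ₁.incl (op A) 1
        rw [PNat.one_coe, pow_one, pullGp_id, map_one, mul_one] }
  have h := quot_mem Ψ₁ Ψ₂ ΨBase E G η ηnat hdeg hdiv G' η' ηnat' hdeg' hdiv' s
  have hd : (ModelFrobenioid.degFr s : ℕ) = 1 := PNat.one_coe
  have hb : ModelFrobenioid.baseMap s = 𝟙 A := rfl
  rw [hd, pow_one, hb, ΨBase.map_id, pullGp_id] at h
  exact h

include ηnat hdeg hdiv ηnat' hdeg' hdiv' in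
/-- The morphism `(2, id, 0, 1) : (A, α) → (A, 2α)` of `Ψ₁.ModelOf` gives
`n(A, α)² / n(A, 2α) ∈ Ψ₂(Ψ^Base A)`. [cite: MochizukiFrdI2008, Thm. 5.2 (i) p.100] -/
theorem quot_mem_sq (A : D₁) (α : Algebra.GrothendieckGroup (Φ₁.obj (op A))) :
    (pullGp Φ₂ (η ⟨A, α⟩).inv (G.obj ⟨A, α⟩).cls / pullGp Φ₂ (η' ⟨A, α⟩).inv (G'.obj ⟨A, α⟩).cls) ^ 2 /
        (pullGp Φ₂ (η ⟨A, α ^ 2⟩).inv (G.obj ⟨A, α ^ 2⟩).cls /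
          pullGp Φ₂ (η' ⟨A, α ^ 2⟩).inv (G'.obj ⟨A, α ^ 2⟩).cls) ∈
      Ψ₂.carrier (ΨBase.obj A) := by
  -- the morphism `(2, id, 0, 1)`
  let t : (⟨A, α⟩ : Ψ₁.ModelOf) ⟶ ⟨A, α ^ 2⟩ :=
    { degFr := 2
      base := 𝟙 A
      div := 1
      unit := 1
      rel := by
        show α ^ ((2 : ℕ+) : ℕ) * Algebra.GrothendieckGroup.of 1 =
          pullGp Φ₁ (𝟙 A) (α ^ 2) * divB Φ₁ Ψ₁.toMonoid Ψ₁.incl (op A) 1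
        rw [map_one, map_one, mul_one, mul_one, pullGp_id]
        rfl }
  have h := quot_mem Ψ₁ Ψ₂ ΨBase E G η ηnat hdeg hdiv G' η' ηnat' hdeg' hdiv' t
  have hd : (ModelFrobenioid.degFr t : ℕ) = 2 := rfl
  have hb : ModelFrobenioid.baseMap t = 𝟙 A := rfl
  rw [hd, hb, ΨBase.map_id, pullGp_id] at h
  exact h

include ηnat hdeg hdiv ηnat' hdeg' hdiv' in
/-- `n(A, α) / n(A, α') ∈ Ψ₂(Ψ^Base A)` for all `α, α' ∈ Φ₁(A)^gp`: write `α' + b = α + a` with `a, b ∈ Φ₁(A)`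
(§0: every element of `M^gp` is a difference of elements of `M`) and use `(1, id, a, 1)`, `(1, id, b, 1)`.
[cite: MochizukiFrdI2008, Thm. 5.2 (i) p.100] -/
theorem quot_mem_pair (A : D₁) (α α' : Algebra.GrothendieckGroup (Φ₁.obj (op A))) :
    (pullGp Φ₂ (η ⟨A, α⟩).inv (G.obj ⟨A, α⟩).cls / pullGp Φ₂ (η' ⟨A, α⟩).inv (G'.obj ⟨A, α⟩).cls) /
        (pullGp Φ₂ (η ⟨A, α'⟩).inv (G.obj ⟨A, α'⟩).cls / pullGp Φ₂ (η' ⟨A, α'⟩).inv (G'.obj ⟨A, α'⟩).cls) ∈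
      Ψ₂.carrier (ΨBase.obj A) := by
  obtain ⟨a, b, hab⟩ := exists_mul_of_eq_of (α⁻¹ * α')
  have hαβ : α * Algebra.GrothendieckGroup.of a = α' * Algebra.GrothendieckGroup.of b := by
    rw [← hab, ← mul_assoc, mul_inv_cancel_left]
  have h₁ := quot_mem_mul_of Ψ₁ Ψ₂ ΨBase E G η ηnat hdeg hdiv G' η' ηnat' hdeg' hdiv' A α a
  have h₂ := quot_mem_mul_of Ψ₁ Ψ₂ ΨBase E G η ηnat hdeg hdiv G' η' ηnat' hdeg' hdiv' A α' b
  rw [hαβ] at h₁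
  have h := Subgroup.div_mem _ h₁ h₂
  rwa [div_div_div_cancel_right] at h

include ηnat hdeg hdiv ηnat' hdeg' hdiv' in
/-- **The transported classes differ by an element of `Ψ₂`**: for every object `X = (A, α)` of
`Ψ₁.ModelOf`, `Φ(η_X⁻¹)(cls(G X)) / Φ(η'_X⁻¹)(cls(G' X)) ∈ Ψ₂(Ψ^Base A)` (`n(X) = n(X)²/n(2X) · n(2X)/n(X)`).
[cite: MochizukiFrdI2008, Cor. 5.4 p.104] -/
theorem transport_div_mem (X : Ψ₁.ModelOf) :
    pullGp Φ₂ (η X).inv (G.obj X).cls / pullGp Φ₂ (η' X).inv (G'.obj X).cls ∈ Ψ₂.carrier (ΨBase.obj X.base) := by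
  obtain ⟨A, α⟩ := X
  have h₁ := quot_mem_sq Ψ₁ Ψ₂ ΨBase E G η ηnat hdeg hdiv G' η' ηnat' hdeg' hdiv' A α
  have h₂ := quot_mem_pair Ψ₁ Ψ₂ ΨBase E G η ηnat hdeg hdiv G' η' ηnat' hdeg' hdiv' A (α ^ 2) α
  have h := Subgroup.mul_mem _ h₁ h₂
  have hx : ∀ y : Algebra.GrothendieckGroup (Φ₂.obj (op (ΨBase.obj A))), y ^ 2 / y = y :=
    fun y => by rw [pow_two, mul_div_cancel_right]
  rw [div_mul_div_cancel, hx] at h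
  exact h

include ηnat hdeg hdiv ηnat' hdeg' hdiv' in
/-- The same in the coordinates of `G X`: `cls(G X) / Φ(η_X ∘ η'_X⁻¹)(cls(G' X)) ∈ Ψ₂((G X)_D)` — the
`Div_B(u)` of the comparison morphism `G X → G' X`. [cite: MochizukiFrdI2008, Cor. 5.4 p.104] -/
theorem cls_div_mem (X : Ψ₁.ModelOf) :
    (G.obj X).cls / pullGp Φ₂ ((η X).hom ≫ (η' X).inv) (G'.obj X).cls ∈ Ψ₂.carrier (G.obj X).base := by
  have h := Ψ₂.pull_mem (η X).hom
    (transport_div_mem Ψ₁ Ψ₂ ΨBase E G η ηnat hdeg hdiv G' η' ηnat' hdeg' hdiv' X)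
  rw [map_div (pullGp Φ₂ (η X).hom), pullGp_hom_inv, ← pullGp_comp] at h
  exact h

include ηnat hdeg hdiv ηnat' hdeg' hdiv' in
/-- **Two functors induced by the same data are isomorphic** (the 1-uniqueness of Cor. 5.4 in honest
form, for model Frobenioids of arbitrary group subfunctors): the comparison isomorphism `G X ⥲ G' X` is
`(1, η_X ∘ η'_X⁻¹, 0, u_X)` with `Div_B(u_X) = cls(G X) − Φ(η_X ∘ η'_X⁻¹)(cls(G' X))`; naturality holds
because morphisms of `Ψ₂.ModelOf` are determined by `(deg_Fr, Base, Div)`.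
[cite: MochizukiFrdI2008, Cor. 5.4 p.104] -/
theorem nonempty_iso : Nonempty (G ≅ G') := by
  refine ⟨NatIso.ofComponents (fun X => ?_) ?_⟩
  · exact
      { hom :=
          { degFr := 1
            base := (η X).hom ≫ (η' X).inv
            div := 1
            unit := ⟨(G.obj X).cls / pullGp Φ₂ ((η X).hom ≫ (η' X).inv) (G'.obj X).cls,
              cls_div_mem Ψ₁ Ψ₂ ΨBase E G η ηnat hdeg hdiv G' η' ηnat' hdeg' hdiv' X⟩
            rel := by
              show (G.obj X).cls ^ ((1 : ℕ+) : ℕ) * Algebra.GrothendieckGroup.of 1 =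
                pullGp Φ₂ ((η X).hom ≫ (η' X).inv) (G'.obj X).cls *
                  ((G.obj X).cls / pullGp Φ₂ ((η X).hom ≫ (η' X).inv) (G'.obj X).cls)
              rw [PNat.one_coe, pow_one, map_one, mul_one, mul_div_cancel] }
        inv :=
          { degFr := 1
            base := (η' X).hom ≫ (η X).inv
            div := 1
            unit := ⟨(G'.obj X).cls / pullGp Φ₂ ((η' X).hom ≫ (η X).inv) (G.obj X).cls,
              cls_div_mem Ψ₁ Ψ₂ ΨBase E G' η' ηnat' hdeg' hdiv' G η ηnat hdeg hdiv X⟩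
            rel := by
              show (G'.obj X).cls ^ ((1 : ℕ+) : ℕ) * Algebra.GrothendieckGroup.of 1 =
                pullGp Φ₂ ((η' X).hom ≫ (η X).inv) (G.obj X).cls *
                  ((G'.obj X).cls / pullGp Φ₂ ((η' X).hom ≫ (η X).inv) (G.obj X).cls)
              rw [PNat.one_coe, pow_one, map_one, mul_one, mul_div_cancel] }
        hom_inv_id := by
          apply hom_eq Ψ₂
          · rfl
          · show ((η X).hom ≫ (η' X).inv) ≫ (η' X).hom ≫ (η X).inv = 𝟙 _
            rw [Category.assoc, Iso.inv_hom_id_assoc, Iso.hom_inv_id]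
          · show pull Φ₂ ((η X).hom ≫ (η' X).inv) 1 * 1 ^ ((1 : ℕ+) : ℕ) = 1
            rw [map_one, one_pow, mul_one]
        inv_hom_id := by
          apply hom_eq Ψ₂
          · rfl
          · show ((η' X).hom ≫ (η X).inv) ≫ (η X).hom ≫ (η' X).inv = 𝟙 _
            rw [Category.assoc, Iso.inv_hom_id_assoc, Iso.hom_inv_id]
          · show pull Φ₂ ((η' X).hom ≫ (η X).inv) 1 * 1 ^ ((1 : ℕ+) : ℕ) = 1
            rw [map_one, one_pow, mul_one] }
  · intro X Y f
    apply hom_eq Ψ₂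
    · show 1 * ModelFrobenioid.degFr (G.map f) = ModelFrobenioid.degFr (G'.map f) * 1
      rw [one_mul, mul_one, hdeg f, hdeg' f]
    · show ModelFrobenioid.baseMap (G.map f) ≫ (η Y).hom ≫ (η' Y).inv =
        ((η X).hom ≫ (η' X).inv) ≫ ModelFrobenioid.baseMap (G'.map f)
      rw [← Category.assoc, ηnat f, Category.assoc, Category.assoc,
        inv_comp_baseMap Ψ₁ Ψ₂ ΨBase G' η' ηnat' f]
    · show pull Φ₂ (ModelFrobenioid.baseMap (G.map f)) 1 *
          ModelFrobenioid.div (G.map f) ^ ((1 : ℕ+) : ℕ) =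
        pull Φ₂ ((η X).hom ≫ (η' X).inv) (ModelFrobenioid.div (G'.map f)) * 1 ^ _
      rw [map_one, one_mul, PNat.one_coe, pow_one, one_pow, mul_one, hdiv f, hdiv' f, ← pull_comp,
        Category.assoc, Iso.inv_hom_id, Category.comp_id]

end Two

end Cor54Unique

end PreFrobenioid

/-! ### The slot of the statements file -/

namespace FrdI.Cor54Sub

universe v₁ u₁ v₂ u₂

variable {D₁ : Type u₁'} [Category.{v₁'} D₁] {Φ₁ : D₁ᵒᵖ ⥤ CommMonCat.{w}}
  {C₁ : Type u₁} [Category.{v₁} C₁] (F₁ : C₁ ⥤ ElemFrobenioid Φ₁) (hΦ₁ : PreFrobenioid.IsPerfFactorialOn Φ₁)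
  {D₂ : Type u₂'} [Category.{v₂'} D₂] {Φ₂ : D₂ᵒᵖ ⥤ CommMonCat.{w}}
  {C₂ : Type u₂} [Category.{v₂} C₂] (F₂ : C₂ ⥤ ElemFrobenioid Φ₂) (hΦ₂ : PreFrobenioid.IsPerfFactorialOn Φ₂)

/-- **Row C54/L07 `FrdI.Cor54Sub.OneUniqueData` HOLDS** (for every `Ψ^Base` and every realified `Ψ^Φ`):
two functors `C₁^rlf → C₂^rlf` both INDUCED BY `(Ψ^Base, (Ψ^Φ)^rlf)` — lying over `Ψ^Base`, preserving
Frobenius degrees, carrying divisors by `(Ψ^Φ)^rlf` — are isomorphic: the 1-uniqueness of `Ψ^rlf` in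
Cor. 5.4 ("there exists a 1-unique functor `Ψ^rlf`", derived in print from the uniqueness of the inducing
data, Cor. 4.10 / 4.11 (ii)(iii)). THE realifications `C_i^rlf` are the model Frobenioids of the group
subfunctors `ℝ · Φ_i^birat ⊆ (Φ_i^rlf)^gp`, so this is `PreFrobenioid.Cor54Unique.nonempty_iso`.
[cite: MochizukiFrdI2008, Cor. 5.4 p.104] -/
theorem oneUniqueData_holds (ΨBase : D₁ ⥤ D₂)
    (Erlf : PreFrobenioidData.DivisorMonoidIsoOverBase (rlfData F₁ hΦ₁) (rlfData F₂ hΦ₂) ΨBase) :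
    OneUniqueData F₁ hΦ₁ F₂ hΦ₂ ΨBase Erlf := by
  intro G G' hG hG'
  obtain ⟨η, hdeg, hdiv⟩ := hG
  obtain ⟨η', hdeg', hdiv'⟩ := hG'
  exact PreFrobenioid.Cor54Unique.nonempty_iso
    ((RealificationData.canonical Φ₁ (PreFrobenioid.IsPerfFactorialOn.op hΦ₁)).realSpan
      (PreFrobenioid.biratSubfunctor F₁))
    ((RealificationData.canonical Φ₂ (PreFrobenioid.IsPerfFactorialOn.op hΦ₂)).realSpan
      (PreFrobenioid.biratSubfunctor F₂))
    ΨBase (fun A x => Erlf.iso A x) G (fun X => η.app X) (fun _ _ f => η.hom.naturality f) hdeg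
    (fun _ _ f => hdiv f) G' (fun X => η'.app X) (fun _ _ f => η'.hom.naturality f) hdeg'
    (fun _ _ f => hdiv' f)

end FrdI.Cor54Sub

end Literature.AlgebraicGeometry.Frobenioids
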